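import Literature.NumberTheory.QuadraticFields.HeegnerCondition
import Mathlib.NumberTheory.NumberField.Ideal.KummerDedekind
import Mathlib.NumberTheory.LegendreSymbol.JacobiSymbol
import Mathlib.FieldTheory.Minpoly.IsIntegrallyClosed
import Mathlib.Algebra.Polynomial.SpecificDegree
import Mathlib.Algebra.Order.Group.Finset
import Mathlib.Tactic.ComputeDegree
import HarnessLib

/-!
# The decomposition law in a quadratic field: `p` splits iff `(d_K / p) = 1`

Topic `NumberTheory/QuadraticFields`, namespace `Literature.NumberTheory.QuadraticFields.Quadratic`
(continuing `HeegnerCondition.lean`). Everything here is PROVED (theorems only, no named facts).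

For a quadratic number field `K` (`[K : ℚ] = 2`, no sign condition) with field discriminant
`d_K = NumberField.discr K` and a rational prime `p`, "`p` splits in `K`" is, as in the tree's
Heegner hypothesis `Literature.SatisfiesHeegnerHypothesis` (`EllipticCurves/HeegnerPoints.lean`),
the statement that there are exactly two primes of `𝓞 K` above `p`:
`((Ideal.span {(p : ℤ)}).primesOver (𝓞 K)).ncard = 2`. We prove the classical decomposition law
(Marcus, *Number Fields*, Ch. 3, Thm. 25; Ireland–Rosen, *A Classical Introduction to Modern
Number Theory*, Props. 13.1.3–13.1.4; Cox, *Primes of the form x² + ny²*, Prop. 5.16), i.e. the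
criterion "`p` splits iff the Kronecker symbol `(d_K / p) = 1`":

* `ncard_primesOver_eq_two_iff_legendreSym` / `ncard_primesOver_eq_two_iff_jacobiSym` — for an
  odd prime `p`: `p` splits iff the Legendre symbol `(d_K / p) = 1` (Mathlib `legendreSym p d_K`,
  equivalently `jacobiSym d_K p`);
* `ncard_primesOver_two_eq_two_iff` — `2` splits iff `d_K ≡ 1 (mod 8)` (the value `+1` of the
  Kronecker symbol `(d_K / 2)`, which Mathlib does not have; `jacobiSym d 2` is NOT it).

## Proof

`HeegnerCondition.lean` gives an integral basis `(1, ω)` of `𝓞 K` without computing `𝓞 K`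
(`exists_basis_zero_eq_one`), with `ω² = m + tω` and `d_K = t² + 4m`
(`discr_eq_sq_add_four_mul`). Hence `𝓞 K = ℤ[ω]` (`adjoin_basis_one_eq_top`), the
Dedekind–Kummer exponent of `ω` is `1` (`exponent_basis_one`), `minpoly_ℤ ω = X² − tX − m`
(`minpoly_basis_one`: it divides this monic quadratic and is not linear since `ω ∉ ℤ`), and
Mathlib's Dedekind–Kummer theorem for number fields
(`NumberField.Ideal.primesOverSpanEquivMonicFactorsMod`) identifies the primes above ANY `p` with
the monic irreducible factors of `X² − tX − m (mod p)` (`ncard_primesOver_eq_card_toFinset`). It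
remains to count those factors for the quadratic `X² − uX − v` over a field
(`card_toFinset_normalizedFactors_X_sq_sub_of_sq_eq`, `…_of_eq_zero`, `…_of_not_isSquare`): two
iff `u² + 4v` is a non-zero square when `2 ≠ 0`; over `𝔽₂` the four cases are done by hand
(`X²`, `(X+1)²`, `X(X+1)`, `X²+X+1`), and `t` odd, `m` even iff `t² + 4m ≡ 1 (mod 8)`.

The converse direction complements `HeegnerCondition.lean`
(`exists_dvd_sq_sub_discr_of_ncard_primesOver`: if every `p ∣ N` splits then `d_K ≡ β² (mod 4N)`).
Used by `Literature/NumberTheory/EllipticCurves/NonvanishingTwistsKronecker.lean` to pass between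
the printed form "`χ_{d_K}(ℓ) = 1` for all `ℓ ∣ N`" of the non-vanishing theorems for quadratic
twists (Darmon 2004, §3.9; Murty–Murty; Bump–Friedberg–Hoffstein) and the Heegner hypothesis
"every `ℓ ∣ N` splits in `K`". Mathlib has Dedekind–Kummer and the Legendre/Jacobi symbols but no
quadratic fields as such (searched `QuadraticField`, `kroneckerSym`, `primesOver` + `legendreSym`).

## References

* D. A. Marcus, *Number Fields*, 2nd ed., Universitext (2018), Ch. 2 Thm. 1, Ch. 3 Thms. 25, 27.
* K. Ireland, M. Rosen, *A Classical Introduction to Modern Number Theory*, 2nd ed., GTM 84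
  (1990), §13.1, Props. 13.1.3–13.1.4.
* D. A. Cox, *Primes of the form `x² + ny²`*, 2nd ed. (2013), Prop. 5.16 and Cor. 5.17.
-/

noncomputable section

open Module NumberField Polynomial Ideal UniqueFactorizationMonoid

namespace Literature.NumberTheory.QuadraticFields.Quadratic

/-! ### Counting monic irreducible factors of a quadratic over a field -/

section Field

variable {F : Type*} [Field F] [DecidableEq F]

/-- A product of two distinct monic linear polynomials has exactly two monic irreducible
factors. [folklore] -/
theorem card_toFinset_normalizedFactors_mul_of_ne {a c : F} (h : a ≠ c) :
    (normalizedFactors ((X - C a) * (X - C c))).toFinset.card = 2 := by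
  rw [normalizedFactors_mul (X_sub_C_ne_zero a) (X_sub_C_ne_zero c),
    normalizedFactors_irreducible (irreducible_X_sub_C a),
    normalizedFactors_irreducible (irreducible_X_sub_C c),
    (monic_X_sub_C a).normalize_eq_self, (monic_X_sub_C c).normalize_eq_self,
    Multiset.toFinset_add, Multiset.toFinset_singleton, Multiset.toFinset_singleton]
  rw [show ({X - C a} ∪ {X - C c} : Finset F[X]) = {X - C a, X - C c} by rfl]
  refine Finset.card_pair fun hac => h ?_
  have := congr_arg (fun q : F[X] => - q.eval 0) hac
  simpa using this

/-- The square of a monic linear polynomial has exactly one monic irreducible factor. [folklore] -/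
theorem card_toFinset_normalizedFactors_sq (a : F) :
    (normalizedFactors ((X - C a) ^ 2)).toFinset.card = 1 := by
  rw [normalizedFactors_pow, Multiset.toFinset_nsmul _ _ two_ne_zero,
    normalizedFactors_irreducible (irreducible_X_sub_C a), (monic_X_sub_C a).normalize_eq_self,
    Multiset.toFinset_singleton, Finset.card_singleton]

/-- An irreducible polynomial has exactly one monic irreducible factor. [folklore] -/
theorem card_toFinset_normalizedFactors_of_irreducible {f : F[X]} (hf : Irreducible f) :
    (normalizedFactors f).toFinset.card = 1 := by
  rw [normalizedFactors_irreducible hf, Multiset.toFinset_singleton, Finset.card_singleton]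

end Field

/-! ### `𝓞 K = ℤ[ω]` and the minimal polynomial of `ω` -/

section Basis

variable {K : Type*} [Field K] [NumberField K]

omit [NumberField K] in
/-- For a `ℤ`-basis `(1, ω)` of `𝓞 K`, `ω` generates `𝓞 K` as a ring: `𝓞 K = ℤ[ω]`. [folklore] -/
theorem adjoin_basis_one_eq_top (b : Basis (Fin 2) ℤ (𝓞 K)) (hb : b 0 = 1) :
    Algebra.adjoin ℤ ({b 1} : Set (𝓞 K)) = ⊤ := by
  refine Algebra.eq_top_iff.mpr fun x => ?_
  have hx : x = (b.repr x 0 : 𝓞 K) + (b.repr x 1 : 𝓞 K) * b 1 := by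
    conv_lhs => rw [← b.sum_repr x]
    rw [Fin.sum_univ_two, hb, zsmul_eq_mul, mul_one, zsmul_eq_mul]
  rw [hx]
  refine Subalgebra.add_mem _ (Subalgebra.intCast_mem _ _)
    (Subalgebra.mul_mem _ (Subalgebra.intCast_mem _ _) (Algebra.self_mem_adjoin_singleton ℤ _))

omit [NumberField K] in
/-- Hence the Dedekind–Kummer exponent of `ω` is `1` (no prime is exceptional). [folklore] -/
theorem exponent_basis_one (b : Basis (Fin 2) ℤ (𝓞 K)) (hb : b 0 = 1) :
    RingOfIntegers.exponent (b 1) = 1 :=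
  RingOfIntegers.exponent_eq_one_iff.mpr (adjoin_basis_one_eq_top b hb)

omit [NumberField K] in
/-- `ω` is a root of `X² − tX − m`, where `ω² = m + tω`. [folklore] -/
theorem aeval_basis_one (b : Basis (Fin 2) ℤ (𝓞 K)) (hb : b 0 = 1) :
    aeval (b 1) (X ^ 2 - C (b.repr (b 1 * b 1) 1) * X - C (b.repr (b 1 * b 1) 0)) = 0 := by
  set t : ℤ := b.repr (b 1 * b 1) 1 with ht
  set m : ℤ := b.repr (b 1 * b 1) 0 with hm
  have h : b 1 * b 1 = (m : 𝓞 K) + (t : 𝓞 K) * b 1 := basis_one_mul_self_eq b hb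
  simp only [map_sub, map_mul, aeval_C, aeval_X, map_pow]
  simp only [eq_intCast]
  rw [sq, h]
  ring

/-- `X² − tX − m` is monic of degree `2`. [folklore] -/
theorem monic_X_sq_sub (t m : ℤ) : (X ^ 2 - C t * X - C m : ℤ[X]).Monic := by
  monicity!

/-- `X² − tX − m` has degree `2`. [folklore] -/
theorem natDegree_X_sq_sub {R : Type*} [CommRing R] [Nontrivial R] (t m : R) :
    (X ^ 2 - C t * X - C m : R[X]).natDegree = 2 := by
  compute_degree!

omit [NumberField K] in
/-- `ω ∉ ℤ`: the second vector of a basis `(1, ω)` is not an integer. [folklore] -/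
theorem basis_one_notMem_range (b : Basis (Fin 2) ℤ (𝓞 K)) (hb : b 0 = 1) :
    b 1 ∉ (algebraMap ℤ (𝓞 K)).range := by
  rintro ⟨n, hn⟩
  have h1 : b.repr (b 1) 1 = 1 := by simp
  have h2 : b.repr (algebraMap ℤ (𝓞 K) n) 1 = 0 := by
    rw [show algebraMap ℤ (𝓞 K) n = n • b 0 by rw [hb, zsmul_eq_mul, mul_one]; rfl,
      map_zsmul, b.repr_self]
    simp
  rw [hn] at h2
  rw [h2] at h1
  exact zero_ne_one h1

/-- **The minimal polynomial of `ω` is `X² − tX − m`** (`ω² = m + tω`, `ω ∉ ℤ`). [folklore] -/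
theorem minpoly_basis_one (b : Basis (Fin 2) ℤ (𝓞 K)) (hb : b 0 = 1) :
    minpoly ℤ (b 1) = X ^ 2 - C (b.repr (b 1 * b 1) 1) * X - C (b.repr (b 1 * b 1) 0) := by
  set f : ℤ[X] := X ^ 2 - C (b.repr (b 1 * b 1) 1) * X - C (b.repr (b 1 * b 1) 0) with hf
  have hint : IsIntegral ℤ (b 1) := RingOfIntegers.isIntegral (b 1)
  have hfm : f.Monic := monic_X_sq_sub _ _
  have hdvd : minpoly ℤ (b 1) ∣ f := minpoly.isIntegrallyClosed_dvd hint (aeval_basis_one b hb)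
  have hle : (minpoly ℤ (b 1)).natDegree ≤ 2 := by
    have := natDegree_le_of_dvd hdvd hfm.ne_zero
    rwa [natDegree_X_sq_sub] at this
  have hpos : 0 < (minpoly ℤ (b 1)).natDegree := minpoly.natDegree_pos hint
  have hne : (minpoly ℤ (b 1)).natDegree ≠ 1 := by
    intro h1
    exact basis_one_notMem_range b hb (minpoly.natDegree_eq_one_iff.mp h1)
  have h2 : (minpoly ℤ (b 1)).natDegree = 2 := by omega
  symm
  refine eq_of_monic_of_dvd_of_natDegree_le (minpoly.monic hint) hfm hdvd ?_
  rw [h2, natDegree_X_sq_sub]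

end Basis

/-! ### Factorisations of `X² − uX − v` over a field -/

section Quadratic

variable {F : Type*} [Field F] [DecidableEq F]

omit [DecidableEq F] in
/-- Vieta: if `a + c = u` and `ac = −v` then `X² − uX − v = (X − a)(X − c)`. [folklore] -/
theorem X_sq_sub_eq_mul {u v a c : F} (hsum : a + c = u) (hprod : a * c = -v) :
    (X ^ 2 - C u * X - C v : F[X]) = (X - C a) * (X - C c) := by
  rw [← hsum, show v = -(a * c) by rw [hprod, neg_neg], C_neg, C_add, C_mul]
  ring

omit [DecidableEq F] in
/-- Completing the square: if `s² = u² + 4v` and `2 ≠ 0`, then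
`X² − uX − v = (X − (u+s)/2)(X − (u−s)/2)`. [folklore] -/
theorem X_sq_sub_eq_mul_of_sq_eq [NeZero (2 : F)] {u v s : F} (hs : s ^ 2 = u ^ 2 + 4 * v) :
    (X ^ 2 - C u * X - C v : F[X]) = (X - C ((u + s) / 2)) * (X - C ((u - s) / 2)) := by
  have h2 : (2 : F) ≠ 0 := NeZero.ne 2
  refine X_sq_sub_eq_mul ?_ ?_
  · field_simp
    ring
  · field_simp
    linear_combination (-1 : F) * hs

omit [DecidableEq F] in
/-- If `u² + 4v = 0` and `2 ≠ 0`, then `X² − uX − v = (X − u/2)²`. [folklore] -/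
theorem X_sq_sub_eq_sq_of_eq_zero [NeZero (2 : F)] {u v : F} (h0 : u ^ 2 + 4 * v = 0) :
    (X ^ 2 - C u * X - C v : F[X]) = (X - C (u / 2)) ^ 2 := by
  have h2 : (2 : F) ≠ 0 := NeZero.ne 2
  rw [sq (X - C (u / 2))]
  refine X_sq_sub_eq_mul ?_ ?_
  · field_simp
    ring
  · field_simp
    linear_combination h0

omit [DecidableEq F] in
/-- If `u² + 4v` is not a square, then `X² − uX − v` has no root (`(2r − u)² = u² + 4v` for a
root `r`), hence is irreducible. [folklore] -/
theorem irreducible_X_sq_sub_of_not_isSquare {u v : F} (h : ¬ IsSquare (u ^ 2 + 4 * v)) :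
    Irreducible (X ^ 2 - C u * X - C v : F[X]) := by
  refine irreducible_of_degree_le_three_of_not_isRoot ?_ fun r hr => h ?_
  · rw [natDegree_X_sq_sub]
    decide
  · simp only [IsRoot.def, eval_sub, eval_pow, eval_X, eval_mul, eval_C] at hr
    exact ⟨2 * r - u, by linear_combination (-4 : F) * hr⟩

/-- **Two monic irreducible factors when the discriminant is a non-zero square** (`2 ≠ 0`).
[folklore] -/
theorem card_toFinset_normalizedFactors_X_sq_sub_of_sq_eq [NeZero (2 : F)] {u v s : F}
    (hs : s ^ 2 = u ^ 2 + 4 * v) (hs0 : s ≠ 0) :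
    (normalizedFactors (X ^ 2 - C u * X - C v : F[X])).toFinset.card = 2 := by
  have h2 : (2 : F) ≠ 0 := NeZero.ne 2
  rw [X_sq_sub_eq_mul_of_sq_eq hs]
  refine card_toFinset_normalizedFactors_mul_of_ne fun hac => hs0 ?_
  have h1 : 2 * s = 0 := by
    have := sub_eq_zero.mpr hac
    field_simp at this
    linear_combination this
  exact (mul_eq_zero.mp h1).resolve_left h2

/-- **One monic irreducible factor when the discriminant vanishes** (`2 ≠ 0`). [folklore] -/
theorem card_toFinset_normalizedFactors_X_sq_sub_of_eq_zero [NeZero (2 : F)] {u v : F}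
    (h0 : u ^ 2 + 4 * v = 0) :
    (normalizedFactors (X ^ 2 - C u * X - C v : F[X])).toFinset.card = 1 := by
  rw [X_sq_sub_eq_sq_of_eq_zero h0]
  exact card_toFinset_normalizedFactors_sq _

/-- **One monic irreducible factor when the discriminant is a non-square.** [folklore] -/
theorem card_toFinset_normalizedFactors_X_sq_sub_of_not_isSquare {u v : F}
    (h : ¬ IsSquare (u ^ 2 + 4 * v)) :
    (normalizedFactors (X ^ 2 - C u * X - C v : F[X])).toFinset.card = 1 :=
  card_toFinset_normalizedFactors_of_irreducible (irreducible_X_sq_sub_of_not_isSquare h)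

/-! Over `𝔽₂`: the four quadratics `X² − uX − v` by hand. -/

/-- `X² = (X − 0)²` over any field: one factor. [folklore] -/
theorem card_toFinset_normalizedFactors_X_sq_sub_zero_zero :
    (normalizedFactors (X ^ 2 - C 0 * X - C 0 : F[X])).toFinset.card = 1 := by
  rw [show (X ^ 2 - C 0 * X - C 0 : F[X]) = (X - C 0) ^ 2 by
    rw [sq (X - C 0)]; exact X_sq_sub_eq_mul (by ring) (by ring)]
  exact card_toFinset_normalizedFactors_sq _

/-- `X² − X = X(X − 1)` over any field: two factors. [folklore] -/
theorem card_toFinset_normalizedFactors_X_sq_sub_one_zero :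
    (normalizedFactors (X ^ 2 - C 1 * X - C 0 : F[X])).toFinset.card = 2 := by
  rw [show (X ^ 2 - C 1 * X - C 0 : F[X]) = (X - C 0) * (X - C 1) from
    X_sq_sub_eq_mul (by ring) (by ring)]
  exact card_toFinset_normalizedFactors_mul_of_ne zero_ne_one

/-- `X² − 1 = (X − 1)²` over `𝔽₂`: one factor. [folklore] -/
theorem card_toFinset_normalizedFactors_X_sq_sub_zero_one_zmod_two :
    (normalizedFactors (X ^ 2 - C 0 * X - C 1 : (ZMod 2)[X])).toFinset.card = 1 := by
  rw [show (X ^ 2 - C 0 * X - C 1 : (ZMod 2)[X]) = (X - C 1) ^ 2 by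
    rw [sq (X - C 1)]; exact X_sq_sub_eq_mul (by decide) (by decide)]
  exact card_toFinset_normalizedFactors_sq _

/-- `X² − X − 1 = X² + X + 1` is irreducible over `𝔽₂`: one factor. [folklore] -/
theorem card_toFinset_normalizedFactors_X_sq_sub_one_one_zmod_two :
    (normalizedFactors (X ^ 2 - C 1 * X - C 1 : (ZMod 2)[X])).toFinset.card = 1 := by
  refine card_toFinset_normalizedFactors_of_irreducible
    (irreducible_of_degree_le_three_of_not_isRoot ?_ fun r hr => ?_)
  · rw [natDegree_X_sq_sub]
    decide
  · simp only [IsRoot.def, eval_sub, eval_pow, eval_X, eval_mul, eval_C] at hr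
    revert r
    decide

end Quadratic

/-! ### Dedekind–Kummer count and the decomposition law -/

section Split

variable {K : Type*} [Field K] [NumberField K]

/-- **Dedekind–Kummer for `𝓞 K = ℤ[ω]`.** The number of primes of `𝓞 K` above a rational prime
`p` equals the number of distinct monic irreducible factors of `X² − tX − m` modulo `p`, where
`(1, ω)` is an integral basis with `ω² = m + tω` (Marcus, *Number Fields*, Ch. 3, Thm. 27, via
Mathlib's `NumberField.Ideal.primesOverSpanEquivMonicFactorsMod` at exponent `1`). [folklore] -/
theorem ncard_primesOver_eq_card_toFinset (b : Basis (Fin 2) ℤ (𝓞 K)) (hb : b 0 = 1) {p : ℕ}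
    [hp : Fact p.Prime] :
    ((span {(p : ℤ)}).primesOver (𝓞 K)).ncard =
      (normalizedFactors (X ^ 2 - C ((b.repr (b 1 * b 1) 1 : ℤ) : ZMod p) * X
        - C ((b.repr (b 1 * b 1) 0 : ℤ) : ZMod p))).toFinset.card := by
  have hexp : ¬ p ∣ RingOfIntegers.exponent (b 1) := by
    rw [exponent_basis_one b hb, Nat.dvd_one]
    exact hp.out.ne_one
  have e := NumberField.Ideal.primesOverSpanEquivMonicFactorsMod (K := K) hexp
  rw [← Nat.card_coe_set_eq, Nat.card_congr e, Nat.card_eq_fintype_card, Fintype.card_coe]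
  simp only [RingOfIntegers.monicFactorsMod, minpoly_basis_one b hb, Polynomial.map_sub,
    Polynomial.map_mul, Polynomial.map_pow, map_X, map_C]
  simp only [eq_intCast]

/-- `2 ≠ 0` in `ZMod p` for a prime `p ≠ 2`. [folklore] -/
theorem two_ne_zero_zmod {p : ℕ} [hp : Fact p.Prime] (hp2 : p ≠ 2) : (2 : ZMod p) ≠ 0 := by
  intro h0
  have h0' : ((2 : ℕ) : ZMod p) = 0 := by exact_mod_cast h0
  rw [ZMod.natCast_eq_zero_iff] at h0'
  exact hp2 ((Nat.prime_dvd_prime_iff_eq hp.out Nat.prime_two).mp h0')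

/-- **Decomposition law at an odd prime.** For a quadratic field `K` and an odd prime `p`:
`p` splits in `K` (two primes of `𝓞 K` above `p`) iff the Legendre symbol `(d_K / p) = 1`
(Marcus, *Number Fields*, Ch. 3, Thm. 25; Ireland–Rosen, Prop. 13.1.3). Proof: with an integral
basis `(1, ω)`, `ω² = m + tω`, `d_K = t² + 4m` is the discriminant of `minpoly ω = X² − tX − m`,
and modulo `p ≠ 2` this quadratic has two distinct roots iff `d_K` is a non-zero square.
[folklore] -/
theorem ncard_primesOver_eq_two_iff_legendreSym (h2 : finrank ℚ K = 2) {p : ℕ} [hp : Fact p.Prime]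
    (hp2 : p ≠ 2) :
    ((span {(p : ℤ)}).primesOver (𝓞 K)).ncard = 2 ↔ legendreSym p (NumberField.discr K) = 1 := by
  obtain ⟨b, hb⟩ := exists_basis_zero_eq_one h2
  haveI : NeZero (2 : ZMod p) := ⟨two_ne_zero_zmod hp2⟩
  rw [ncard_primesOver_eq_card_toFinset b hb, discr_eq_sq_add_four_mul b hb]
  generalize b.repr (b 1 * b 1) 1 = t
  generalize b.repr (b 1 * b 1) 0 = m
  have hcast : (((t ^ 2 + 4 * m : ℤ)) : ZMod p) = (t : ZMod p) ^ 2 + 4 * (m : ZMod p) := by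
    push_cast
    ring
  constructor
  · intro hcard
    by_contra hne
    by_cases h0 : ((t ^ 2 + 4 * m : ℤ) : ZMod p) = 0
    · rw [card_toFinset_normalizedFactors_X_sq_sub_of_eq_zero (hcast ▸ h0)] at hcard
      exact absurd hcard (by decide)
    · have hns : ¬ IsSquare ((t : ZMod p) ^ 2 + 4 * (m : ZMod p)) :=
        hcast ▸ (legendreSym.eq_neg_one_iff p).mp ((legendreSym.eq_neg_one_iff_not_one p h0).mpr hne)
      rw [card_toFinset_normalizedFactors_X_sq_sub_of_not_isSquare hns] at hcard
      exact absurd hcard (by decide)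
  · intro h1
    have h0 : ((t ^ 2 + 4 * m : ℤ) : ZMod p) ≠ 0 := fun h0 => by
      rw [(legendreSym.eq_zero_iff p _).mpr h0] at h1
      exact absurd h1 (by decide)
    obtain ⟨s, hs⟩ := (legendreSym.eq_one_iff p h0).mp h1
    refine card_toFinset_normalizedFactors_X_sq_sub_of_sq_eq (s := s) ?_ ?_
    · rw [← hcast, hs, sq]
    · rintro rfl
      exact h0 (by rw [hs, mul_zero])

/-- The same with Mathlib's Jacobi symbol `J(d_K | p)` (equal to the Legendre symbol at a prime),
which needs no `Fact` instance. [folklore] -/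
theorem ncard_primesOver_eq_two_iff_jacobiSym (h2 : finrank ℚ K = 2) {p : ℕ} (hp : p.Prime)
    (hp2 : p ≠ 2) :
    ((span {(p : ℤ)}).primesOver (𝓞 K)).ncard = 2 ↔ jacobiSym (NumberField.discr K) p = 1 := by
  haveI := Fact.mk hp
  rw [← jacobiSym.legendreSym.to_jacobiSym, ncard_primesOver_eq_two_iff_legendreSym h2 hp2]

/-- **Decomposition law at `2`.** For a quadratic field `K`: `2` splits in `K` iff
`d_K ≡ 1 (mod 8)` (the Kronecker symbol `(d_K / 2) = 1`; Marcus, *Number Fields*, Ch. 3,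
Thm. 25; Ireland–Rosen, Prop. 13.1.4). Proof: `minpoly ω = X² − tX − m ≡ X(X + 1) (mod 2)` iff
`t` is odd and `m` even iff `d_K = t² + 4m ≡ 1 (mod 8)`; in the three other parity classes the
reduction is `X²`, `(X + 1)²` or the irreducible `X² + X + 1`. [folklore] -/
theorem ncard_primesOver_two_eq_two_iff (h2 : finrank ℚ K = 2) :
    ((span {(2 : ℤ)}).primesOver (𝓞 K)).ncard = 2 ↔ NumberField.discr K % 8 = 1 := by
  obtain ⟨b, hb⟩ := exists_basis_zero_eq_one h2
  haveI := Fact.mk Nat.prime_two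
  have hc := ncard_primesOver_eq_card_toFinset b hb (p := 2)
  simp only [Nat.cast_ofNat] at hc
  rw [hc, discr_eq_sq_add_four_mul b hb]
  generalize b.repr (b 1 * b 1) 1 = t
  generalize b.repr (b 1 * b 1) 0 = m
  have h20 : (2 : ZMod 2) = 0 := rfl
  have heven : ∀ k : ℤ, ((2 * k : ℤ) : ZMod 2) = 0 := fun k => by
    rw [Int.cast_mul, Int.cast_ofNat, h20, zero_mul]
  have hodd : ∀ k : ℤ, ((2 * k + 1 : ℤ) : ZMod 2) = 1 := fun k => by
    rw [Int.cast_add, Int.cast_mul, Int.cast_ofNat, h20, zero_mul, zero_add, Int.cast_one]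
  obtain ⟨k, rfl | rfl⟩ := Int.even_or_odd' t <;> obtain ⟨j, rfl | rfl⟩ := Int.even_or_odd' m
  · -- `t` even, `m` even: `X²`
    rw [heven, heven, card_toFinset_normalizedFactors_X_sq_sub_zero_zero]
    have : (2 * k) ^ 2 + 4 * (2 * j) = 4 * (k ^ 2 + 2 * j) := by ring
    rw [this]
    generalize k ^ 2 + 2 * j = y
    constructor <;> intro h <;> omega
  · -- `t` even, `m` odd: `X² − 1 = (X + 1)²`
    rw [heven, hodd, card_toFinset_normalizedFactors_X_sq_sub_zero_one_zmod_two]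
    have : (2 * k) ^ 2 + 4 * (2 * j + 1) = 4 * (k ^ 2 + 2 * j + 1) := by ring
    rw [this]
    generalize k ^ 2 + 2 * j + 1 = y
    constructor <;> intro h <;> omega
  · -- `t` odd, `m` even: `X(X + 1)`, the split case
    rw [hodd, heven, card_toFinset_normalizedFactors_X_sq_sub_one_zero]
    obtain ⟨i, hi⟩ := Int.even_mul_succ_self k
    have : (2 * k + 1) ^ 2 + 4 * (2 * j) = 8 * (i + j) + 1 := by linear_combination 4 * hi
    rw [this]
    constructor <;> intro h <;> omega
  · -- `t` odd, `m` odd: `X² + X + 1`, irreducible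
    rw [hodd, hodd, card_toFinset_normalizedFactors_X_sq_sub_one_one_zmod_two]
    obtain ⟨i, hi⟩ := Int.even_mul_succ_self k
    have : (2 * k + 1) ^ 2 + 4 * (2 * j + 1) = 8 * (i + j) + 5 := by linear_combination 4 * hi
    rw [this]
    constructor <;> intro h <;> omega

end Split

end Literature.NumberTheory.QuadraticFields.Quadratic

end
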